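import Summits.ResolutionOfSingularities.ResolutionOfSingularities.Theses.SectionAscent
import Summits.ResolutionOfSingularities.ResolutionOfSingularities.Theorems.SectionAscentFibrewiseClosedPointsOneShotCurves
import Summits.ResolutionOfSingularities.ResolutionOfSingularities.Theorems.WeightedThesis.Negative.LoadBearing
import Literature.AlgebraicGeometry.Resolution.AffineBlowupUniversal
import Literature.AlgebraicGeometry.Resolution.BlowupsProduct
import Literature.AlgebraicGeometry.Resolution.BlowupsScaling
import Literature.AlgebraicGeometry.Resolution.ResolutionGlue
import Literature.AlgebraicGeometry.Resolution.RegularLocalRingsNormal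
import Literature.AlgebraicGeometry.Resolution.AffineDomainDimension

/-!
# `AffineToGlobal` — negative lemmas II: the one-shot centre is never unique at a singular
# variety (the hypothesis cannot be upgraded to `∃!`, so it carries no canonical centre to glue)

Support (negative-side) lemmas for crux `stmt-ResolutionOfSingularities-15961`
(`Summit.ResolutionOfSingularities.ResolutionOfSingularities.Theses.SectionAscent.AffineToGlobal`:
for every prime `p`, affine one-shot strong resolution `OneShot p d` in every dimension `d` ⇒
`ResolutionInChar p`), filed by the crux disprover (cdisprove, gen 2, 2026-08-17). The named
obstruction of the crux (route header; lead's `KERNEL.md`/`KERNEL-2.md`; `Lines/birth-dead.md`)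
is that the hypothesis hands over, on each affine chart, SOME ideal `I` with `Bl_I` regular and
`V(I) = Sing`, with no canonicity to glue chartwise centres. This file makes the first half of
that remark a theorem: the `∃ I` of the hypothesis can NEVER be sharpened to `∃! I` at a singular
variety, because the square of a one-shot centre is again a one-shot centre and differs from it.
No definition is declared; no declaration concludes a route decl positively.

* `isRegular_affineBlowup_mul_self_iff` — `Bl_{I·I}(Spec R)` is regular iff `Bl_I(Spec R)` is:
  the blowing up along `I` is also a blowing up along `I·I` (Stacks 080A with the identity as
  second blow-up), and blow-ups are unique up to isomorphism.
* `centre_iff_mul_self` — `V(I·I) = Sing` iff `V(I) = Sing` (primes are radical for products).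
* `oneShotCentre_mul_self`, `mul_self_ne_self` — hence `I·I` is a one-shot centre whenever `I`
  is, and `I·I ≠ I` for `⊥ ≠ I ≠ ⊤` in a Noetherian domain (finitely generated idempotent
  ideals of a domain are trivial).
* `exists_ne_oneShotCentre` — **at an integral Noetherian affine scheme with a non-regular point,
  every one-shot centre `I` admits a second one-shot centre `J ≠ I`** (namely `I·I`; `I ≠ ⊤`
  because `V(I) = Sing ≠ ∅`).
* `not_isRegularLocalRing_origin_of_coeff_one_eq_zero`, `not_isRegularLocalRing_cusp_origin`,
  `ringKrullDim_eq_one_of_X_sq_mem`, `finiteType_cusp` — the cuspidal cubic `K[X², X³] ⊆ K[X]`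
  over any field (its elements have no linear term: `WeightedThesis.Negative.cusp_coeff_one_eq_zero`,
  reused): it is NOT regular at the ORIGIN (a regular local ring is integrally closed, but
  `X = X³/X²` is integral and not a fraction `a/s`, `s(0) ≠ 0`, of cusp elements — compare
  linear terms; this names the singular point, refining the tree's
  `WeightedThesis.Negative.cusp_exists_not_isRegularLocalRing`), it has Krull dimension `1`
  (integral under `K[X]`) and finite type.
* `exists_two_oneShotCentres` — **for every prime `p` and every field `K` of characteristic `p`
  the cusp over `K` has two distinct one-shot centres** (existence from the landed curve case
  `OneShotCurves.stub_oneShotCurves` = `OneShot p 2`, the conductor; the second is its square).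
* `not_oneShot_two_existsUnique` — **the natural strengthening `∃! I` of the hypothesis
  `OneShot p 2` is false for every prime `p`** (witness: the cusp over `ZMod p`).

Reading for provers of `AffineToGlobal`: nothing in the hypothesis pins the centre down, not even
up to the obvious ambiguity — `I`, `I²`, `I³`, … all qualify and have the same blowing up, and
(Negative lemmas I, `centre_eq_top_of_isRegularRing`) only on regular varieties is the centre
forced. Any gluing argument must therefore supply its own choice principle (canonical or
equivariant centres), which is exactly what three lead generations found missing.

## Sources
* The Stacks Project, Tag 080A (blowing up in a product of ideals), as proved in the tree
  (`IsBlowup.comp`); Görtz–Wedhorn I, Def. 13.90 (uniqueness of blow-ups, `IsBlowup.unique`).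
* H. Matsumura, *Commutative Ring Theory*, Thm. 19.4 with 23.7 (regular local rings are normal),
  as proved in the tree (`isIntegrallyClosed_of_isRegularLocalRing`); Thm. 9.4 (dimension under
  integral extensions, `ringKrullDim_eq_of_isIntegral`).
* V. Cossart, O. Piltant, J. Algebra 529 (2019), Thm. 1.1 and p. 3 (the one-shot statement).
-/

noncomputable section

set_option linter.dupNamespace false -- mandated namespace of this single-conjunct summit

open CategoryTheory AlgebraicGeometry Polynomial
open Literature.AlgebraicGeometry.Resolution
open Summit.ResolutionOfSingularities.ResolutionOfSingularities.Theses.SectionAscent (AffineToGlobal)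

namespace Summit.ResolutionOfSingularities.ResolutionOfSingularities.Theorems.AffineToGlobal.Negative

universe u

/-! ## Powers of a one-shot centre are one-shot centres -/

/-- **`Bl_{I·I}(Spec R)` is regular iff `Bl_I(Spec R)` is.** The blowing up `π` of `Spec R`
along `Ĩ` is also a blowing up along `Ĩ·Ĩ = (I·I)~` (Stacks 080A, `IsBlowup.comp`, with the
identity of `Bl_I` — a blowing up along the effective Cartier divisor `π⁻¹Ĩ` — as second
factor), so `Bl_I ≅ Bl_{I·I}` by uniqueness of blow-ups, and regularity is invariant under
isomorphism. [cite: StacksProject, Tag 080A] -/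
theorem isRegular_affineBlowup_mul_self_iff {R : Type u} [CommRing R] (I : Ideal R) :
    Scheme.IsRegular (affineBlowup (I * I)) ↔ Scheme.IsRegular (affineBlowup I) := by
  have h1 : IsBlowup (affineBlowup.π I) (affineBlowup.idealSheaf I) := affineBlowup.isBlowup I
  have h2 : IsBlowup (𝟙 _ ≫ affineBlowup.π I)
      (affineBlowup.idealSheaf I * affineBlowup.idealSheaf I) :=
    h1.comp (IsBlowup.id h1.isEffectiveCartier)
  rw [Category.id_comp, ← affineBlowup.idealSheaf_mul] at h2
  have h3 : IsBlowup (affineBlowup.π (I * I)) (affineBlowup.idealSheaf (I * I)) :=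
    affineBlowup.isBlowup (I * I)
  obtain ⟨e, -, -⟩ := h2.unique h3
  exact ⟨fun h => Scheme.IsRegular.of_iso e.inv h, fun h => Scheme.IsRegular.of_iso e.hom h⟩

/-- **`V(I·I) = Sing` iff `V(I) = Sing`**: a prime contains `I·I` iff it contains `I`.
[folklore] -/
theorem centre_iff_mul_self {R : Type u} [CommRing R] (I : Ideal R) :
    (∀ 𝔭 : PrimeSpectrum R, I * I ≤ 𝔭.asIdeal ↔
        ¬ IsRegularLocalRing (Localization.AtPrime 𝔭.asIdeal)) ↔
      ∀ 𝔭 : PrimeSpectrum R, I ≤ 𝔭.asIdeal ↔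
        ¬ IsRegularLocalRing (Localization.AtPrime 𝔭.asIdeal) := by
  have key : ∀ 𝔭 : PrimeSpectrum R, I * I ≤ 𝔭.asIdeal ↔ I ≤ 𝔭.asIdeal := fun 𝔭 => by
    rw [𝔭.isPrime.mul_le, or_self]
  exact ⟨fun h 𝔭 => (key 𝔭).symm.trans (h 𝔭), fun h 𝔭 => (key 𝔭).trans (h 𝔭)⟩

/-- **The square of a one-shot centre is a one-shot centre** (same blowing up, same zero set,
still nonzero in a domain). [folklore] -/
theorem oneShotCentre_mul_self {R : Type u} [CommRing R] [IsDomain R] {I : Ideal R}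
    (h : I ≠ ⊥ ∧ Scheme.IsRegular (affineBlowup I) ∧
      ∀ 𝔭 : PrimeSpectrum R, I ≤ 𝔭.asIdeal ↔
        ¬ IsRegularLocalRing (Localization.AtPrime 𝔭.asIdeal)) :
    I * I ≠ ⊥ ∧ Scheme.IsRegular (affineBlowup (I * I)) ∧
      ∀ 𝔭 : PrimeSpectrum R, I * I ≤ 𝔭.asIdeal ↔
        ¬ IsRegularLocalRing (Localization.AtPrime 𝔭.asIdeal) :=
  ⟨fun h0 => (Ideal.mul_eq_bot.mp h0).elim h.1 h.1, (isRegular_affineBlowup_mul_self_iff I).mpr h.2.1,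
    (centre_iff_mul_self I).mpr h.2.2⟩

/-- **`I·I ≠ I` for a nonzero proper ideal of a Noetherian domain**: a finitely generated
idempotent ideal of a domain is `⊥` or `⊤`. [folklore] -/
theorem mul_self_ne_self {R : Type u} [CommRing R] [IsDomain R] [IsNoetherianRing R]
    {I : Ideal R} (h0 : I ≠ ⊥) (h1 : I ≠ ⊤) : I * I ≠ I := by
  intro h
  rcases (Ideal.isIdempotentElem_iff_eq_bot_or_top I (IsNoetherian.noetherian I)).mp h with h' | h'
  · exact h0 h'
  · exact h1 h'

/-- **A one-shot centre of a variety with a non-regular point is a proper ideal** (`V(I) = Sing`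
is non-empty). [folklore] -/
theorem centre_ne_top_of_not_isRegularLocalRing {R : Type u} [CommRing R] {I : Ideal R}
    (h : ∀ 𝔭 : PrimeSpectrum R, I ≤ 𝔭.asIdeal ↔
      ¬ IsRegularLocalRing (Localization.AtPrime 𝔭.asIdeal))
    {𝔭 : PrimeSpectrum R} (h𝔭 : ¬ IsRegularLocalRing (Localization.AtPrime 𝔭.asIdeal)) :
    I ≠ ⊤ := by
  rintro rfl
  exact 𝔭.isPrime.ne_top (top_le_iff.mp ((h 𝔭).mpr h𝔭))

/-- **At a singular integral Noetherian affine scheme the one-shot centre is never unique**: if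
`I` is a one-shot centre (`I ≠ ⊥`, `Bl_I` regular, `V(I) = Sing`) and some local ring of `R` is
not regular, then `I·I` is a second one-shot centre, different from `I`. [folklore] -/
theorem exists_ne_oneShotCentre {R : Type u} [CommRing R] [IsDomain R] [IsNoetherianRing R]
    {I : Ideal R}
    (h : I ≠ ⊥ ∧ Scheme.IsRegular (affineBlowup I) ∧
      ∀ 𝔭 : PrimeSpectrum R, I ≤ 𝔭.asIdeal ↔
        ¬ IsRegularLocalRing (Localization.AtPrime 𝔭.asIdeal))
    (hsing : ∃ 𝔭 : PrimeSpectrum R, ¬ IsRegularLocalRing (Localization.AtPrime 𝔭.asIdeal)) :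
    ∃ J : Ideal R, J ≠ I ∧ J ≠ ⊥ ∧ Scheme.IsRegular (affineBlowup J) ∧
      ∀ 𝔭 : PrimeSpectrum R, J ≤ 𝔭.asIdeal ↔
        ¬ IsRegularLocalRing (Localization.AtPrime 𝔭.asIdeal) := by
  obtain ⟨𝔭, h𝔭⟩ := hsing
  exact ⟨I * I, mul_self_ne_self h.1 (centre_ne_top_of_not_isRegularLocalRing h.2.2 h𝔭),
    oneShotCentre_mul_self h⟩

/-! ## The cuspidal cubic `K[X², X³]`: a singular integral affine curve over any field -/

section Cusp

variable (K : Type) [Field K]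

/-- **A domain embedded in `K[X]` without linear terms and containing `X²`, `X³` is not regular
at the origin.** Here the origin is any prime `𝔭` of `A` consisting exactly of the elements
with vanishing constant term. If `A_𝔭` were regular it would be integrally closed (Matsumura
19.4/23.7, in tree); the fraction `u = X³/X²` has `u² = X² ∈ A_𝔭`, hence would equal some `a/s`
with `a, s ∈ A`, `s(0) ≠ 0`; then `a = sX` in `K[X]`, whose linear coefficient is `s(0) ≠ 0`
on the right and `0` on the left. [cite: Matsumura1987, Thm. 19.4] -/
theorem not_isRegularLocalRing_origin_of_coeff_one_eq_zero {A : Type} [CommRing A] [IsDomain A]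
    (ι : A →+* K[X]) (hι : Function.Injective ι) (hA : ∀ a : A, (ι a).coeff 1 = 0)
    (x₂ x₃ : A) (hx₂ : ι x₂ = X ^ 2) (hx₃ : ι x₃ = X ^ 3)
    (𝔭 : PrimeSpectrum A) (h𝔭 : ∀ a : A, a ∈ 𝔭.asIdeal ↔ (ι a).coeff 0 = 0) :
    ¬ IsRegularLocalRing (Localization.AtPrime 𝔭.asIdeal) := by
  intro hreg
  have hic : IsIntegrallyClosed (Localization.AtPrime 𝔭.asIdeal) :=
    isIntegrallyClosed_of_isRegularLocalRing _
  have hx : x₃ * x₃ = x₂ * x₂ * x₂ := hι (by simp only [map_mul, hx₂, hx₃]; ring)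
  have hx₂0 : x₂ ≠ 0 := by
    intro h
    have h' : (X ^ 2 : K[X]) = 0 := by rw [← hx₂, h, map_zero]
    exact pow_ne_zero 2 Polynomial.X_ne_zero h'
  have hM : 𝔭.asIdeal.primeCompl ≤ nonZeroDivisors A := 𝔭.asIdeal.primeCompl_le_nonZeroDivisors
  have hinjL := IsLocalization.injective (Localization.AtPrime 𝔭.asIdeal) hM
  have hinjA := IsFractionRing.injective A (FractionRing A)
  have hinjF := IsFractionRing.injective (Localization.AtPrime 𝔭.asIdeal) (FractionRing A)
  -- the generators in the fraction field `Frac A = Frac A_𝔭`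
  set a₂ : FractionRing A := algebraMap A (FractionRing A) x₂ with ha₂
  set a₃ : FractionRing A := algebraMap A (FractionRing A) x₃ with ha₃
  have ha₂0 : a₂ ≠ 0 := by
    rw [ha₂, map_ne_zero_iff _ hinjA]
    exact hx₂0
  have hx' : a₃ * a₃ = a₂ * a₂ * a₂ := by
    simp only [ha₂, ha₃, ← map_mul, hx]
  -- `u = X³/X²` has `u² = X²`
  set u : FractionRing A := a₃ / a₂ with hu
  have hu2 : u ^ 2 = a₂ := by
    rw [hu, div_pow, pow_two a₃, pow_two a₂, hx']
    field_simp
  have hint : IsIntegral (Localization.AtPrime 𝔭.asIdeal) (u ^ 2) := by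
    rw [hu2, ha₂, IsScalarTower.algebraMap_apply A (Localization.AtPrime 𝔭.asIdeal) (FractionRing A)]
    exact isIntegral_algebraMap
  obtain ⟨y, hy⟩ := IsIntegrallyClosed.exists_algebraMap_eq_of_isIntegral_pow two_pos hint
  -- `y · X² = X³` in the local ring
  have hyx : y * algebraMap A (Localization.AtPrime 𝔭.asIdeal) x₂ =
      algebraMap A (Localization.AtPrime 𝔭.asIdeal) x₃ := by
    apply hinjF
    rw [map_mul, hy, ← IsScalarTower.algebraMap_apply, ← IsScalarTower.algebraMap_apply, ← ha₂,
      ← ha₃, hu, div_mul_cancel₀ a₃ ha₂0]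
  obtain ⟨⟨a, s⟩, has⟩ := IsLocalization.surj 𝔭.asIdeal.primeCompl y
  -- `a · X² = s · X³` in `A`
  have heq : a * x₂ = (s : A) * x₃ := by
    apply hinjL
    rw [map_mul, map_mul, ← has, mul_assoc,
      mul_comm (algebraMap A (Localization.AtPrime 𝔭.asIdeal) (s : A)), ← mul_assoc, hyx,
      mul_comm]
  have heq' : ι a * X ^ 2 = ι (s : A) * X * X ^ 2 := by
    have h' : ι a * X ^ 2 = ι (s : A) * X ^ 3 := by
      rw [← hx₂, ← hx₃, ← map_mul, ← map_mul, heq]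
    rw [h']
    ring
  have heq'' : ι a = ι (s : A) * X :=
    mul_right_cancel₀ (pow_ne_zero 2 Polynomial.X_ne_zero) heq'
  have h1 : (ι a).coeff 1 = (ι (s : A)).coeff 0 := by
    rw [heq'', Polynomial.coeff_mul_X]
  have hs0 : (ι (s : A)).coeff 0 ≠ 0 := fun h0 => s.2 ((h𝔭 _).mpr h0)
  exact hs0 (h1 ▸ hA a)

/-- **The cusp `K[X², X³]` is not regular at the origin** (the prime of elements with vanishing
constant term). [cite: Matsumura1987, Thm. 19.4] -/
theorem not_isRegularLocalRing_cusp_origin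
    (𝔭 : PrimeSpectrum ↥(Algebra.adjoin K ({X ^ 2, X ^ 3} : Set K[X])))
    (h𝔭 : ∀ a : ↥(Algebra.adjoin K ({X ^ 2, X ^ 3} : Set K[X])),
      a ∈ 𝔭.asIdeal ↔ (a : K[X]).coeff 0 = 0) :
    ¬ IsRegularLocalRing (Localization.AtPrime 𝔭.asIdeal) :=
  not_isRegularLocalRing_origin_of_coeff_one_eq_zero K
    (Algebra.adjoin K ({X ^ 2, X ^ 3} : Set K[X])).val.toRingHom Subtype.val_injective
    (fun a => WeightedThesis.Negative.cusp_coeff_one_eq_zero K a.2)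
    ⟨X ^ 2, Algebra.subset_adjoin (by simp)⟩ ⟨X ^ 3, Algebra.subset_adjoin (by simp)⟩ rfl rfl 𝔭 h𝔭

/-- **The origin exists**: for a ring `A` mapping to `K[X]`, the kernel of `a ↦ (ι a)(0)` is a
prime of `A` consisting exactly of the elements whose image has vanishing constant term.
[folklore] -/
theorem exists_origin {A : Type} [CommRing A] (ι : A →+* K[X]) :
    ∃ 𝔭 : PrimeSpectrum A, ∀ a : A, a ∈ 𝔭.asIdeal ↔ (ι a).coeff 0 = 0 := by
  let φ : A →+* K := (Polynomial.evalRingHom (0 : K)).comp ι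
  refine ⟨⟨RingHom.ker φ, RingHom.ker_isPrime φ⟩, fun a => ?_⟩
  change a ∈ RingHom.ker φ ↔ _
  rw [RingHom.mem_ker, Polynomial.coeff_zero_eq_eval_zero]
  rfl

/-- **The cusp is singular**: some local ring of `K[X², X³]` is not regular. [folklore] -/
theorem exists_not_isRegularLocalRing_cusp :
    ∃ 𝔭 : PrimeSpectrum ↥(Algebra.adjoin K ({X ^ 2, X ^ 3} : Set K[X])),
      ¬ IsRegularLocalRing (Localization.AtPrime 𝔭.asIdeal) := by
  obtain ⟨𝔭, h𝔭⟩ := exists_origin K (Algebra.adjoin K ({X ^ 2, X ^ 3} : Set K[X])).val.toRingHom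
  exact ⟨𝔭, not_isRegularLocalRing_cusp_origin K 𝔭 h𝔭⟩

/-- `K[X]` is integral over any subalgebra containing `X²` (`X` is a root of `T² − X²`).
[folklore] -/
theorem isIntegral_polynomial_of_X_sq_mem (S : Subalgebra K K[X]) (h₂ : (X ^ 2 : K[X]) ∈ S) :
    Algebra.IsIntegral S K[X] := by
  have h2 : IsIntegral S (algebraMap S K[X] ⟨X ^ 2, h₂⟩) := isIntegral_algebraMap
  have hX : IsIntegral S (X : K[X]) := IsIntegral.of_pow two_pos h2
  let T : Subalgebra K K[X] := (integralClosure S K[X]).restrictScalars K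
  have hT : (⊤ : Subalgebra K K[X]) ≤ T := by
    rw [← Polynomial.adjoin_X]
    exact Algebra.adjoin_le (Set.singleton_subset_iff.mpr hX)
  exact ⟨fun f => hT (Algebra.mem_top (x := f))⟩

/-- **A subalgebra of `K[X]` containing `X²` has Krull dimension one** (`K[X]` is integral over
it, and `dim K[X] = 1`). [cite: Matsumura1987, Thm. 9.4] -/
theorem ringKrullDim_eq_one_of_X_sq_mem (S : Subalgebra K K[X]) (h₂ : (X ^ 2 : K[X]) ∈ S) :
    ringKrullDim S = 1 := by
  haveI := isIntegral_polynomial_of_X_sq_mem K S h₂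
  have hinj : Function.Injective (algebraMap S K[X]) := Subtype.val_injective
  rw [← ringKrullDim_eq_of_isIntegral hinj]
  exact IsPrincipalIdealRing.ringKrullDim_eq_one _ (Polynomial.not_isField K)

/-- The cusp has Krull dimension `< 2`. [folklore] -/
theorem ringKrullDim_cusp_lt_two :
    ringKrullDim ↥(Algebra.adjoin K ({X ^ 2, X ^ 3} : Set K[X])) < ((2 : ℕ) : WithBot ℕ∞) := by
  rw [ringKrullDim_eq_one_of_X_sq_mem K _ (Algebra.subset_adjoin (by simp))]
  decide

/-- The cusp is an algebra of finite type over `K`. [folklore] -/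
theorem finiteType_cusp :
    Algebra.FiniteType K ↥(Algebra.adjoin K ({X ^ 2, X ^ 3} : Set K[X])) := by
  rw [← Subalgebra.fg_iff_finiteType, Subalgebra.fg_def]
  exact ⟨{X ^ 2, X ^ 3}, Set.toFinite _, rfl⟩

end Cusp

/-! ## Two one-shot centres in every characteristic; `∃!` fails -/

/-- **For every prime `p` and every field `K` of characteristic `p`, the cusp `K[X², X³]` has two
distinct one-shot centres** (two ideals `I ≠ J`, both nonzero, both with regular blowing up,
both with zero set exactly the non-regular locus): one exists by the landed curve case of the
hypothesis (`OneShot p 2`, the conductor — `OneShotCurves.stub_oneShotCurves`), and its square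
is another. [folklore] -/
theorem exists_two_oneShotCentres (p : ℕ) (hp : p.Prime) (K : Type) [Field K] [CharP K p] :
    ∃ I J : Ideal ↥(Algebra.adjoin K ({X ^ 2, X ^ 3} : Set K[X])), I ≠ J ∧
      (I ≠ ⊥ ∧ Scheme.IsRegular (affineBlowup I) ∧
        ∀ 𝔭 : PrimeSpectrum ↥(Algebra.adjoin K ({X ^ 2, X ^ 3} : Set K[X])), I ≤ 𝔭.asIdeal ↔
          ¬ IsRegularLocalRing (Localization.AtPrime 𝔭.asIdeal)) ∧
      (J ≠ ⊥ ∧ Scheme.IsRegular (affineBlowup J) ∧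
        ∀ 𝔭 : PrimeSpectrum ↥(Algebra.adjoin K ({X ^ 2, X ^ 3} : Set K[X])), J ≤ 𝔭.asIdeal ↔
          ¬ IsRegularLocalRing (Localization.AtPrime 𝔭.asIdeal)) := by
  haveI := finiteType_cusp K
  haveI : IsNoetherianRing ↥(Algebra.adjoin K ({X ^ 2, X ^ 3} : Set K[X])) :=
    Algebra.FiniteType.isNoetherianRing K _
  obtain ⟨I, hI⟩ := _root_.Summit.ResolutionOfSingularities.ResolutionOfSingularities.Theorems.SectionAscent.OneShotCurves.stub_oneShotCurves
    p hp K _ (ringKrullDim_cusp_lt_two K)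
  obtain ⟨J, hJI, hJ⟩ := exists_ne_oneShotCentre hI (exists_not_isRegularLocalRing_cusp K)
  exact ⟨I, J, hJI.symm, hI, hJ⟩

/-- **The natural strengthening `∃! I` of the hypothesis `OneShot p 2` is false for every prime
`p`**: over `ZMod p` the cusp has two distinct one-shot centres. So the crux's hypothesis never
determines its centre, even on curves; provers of `AffineToGlobal` cannot glue "the" chartwise
centre — there is none. [folklore] -/
theorem not_oneShot_two_existsUnique (p : ℕ) (hp : p.Prime) :
    ¬ ∀ (K : Type) [Field K] [CharP K p] (A : Type) [CommRing A] [IsDomain A] [Algebra K A]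
        [Algebra.FiniteType K A], ringKrullDim A < ((2 : ℕ) : WithBot ℕ∞) →
        ∃! I : Ideal A, I ≠ ⊥ ∧ Scheme.IsRegular (affineBlowup I) ∧
          ∀ 𝔭 : PrimeSpectrum A, I ≤ 𝔭.asIdeal ↔
            ¬ IsRegularLocalRing (Localization.AtPrime 𝔭.asIdeal) := by
  intro h
  haveI : Fact p.Prime := ⟨hp⟩
  haveI := finiteType_cusp (ZMod p)
  obtain ⟨I, J, hIJ, hI, hJ⟩ := exists_two_oneShotCentres p hp (ZMod p)
  exact hIJ ((h (ZMod p) _ (ringKrullDim_cusp_lt_two (ZMod p))).unique hI hJ)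

/-- **Corollary for the crux's full hypothesis**: if `∀ d, OneShot p d` holds (the hypothesis of
`AffineToGlobal` at the prime `p`), then at EVERY integral affine variety of finite type over a
field of characteristic `p` with a non-regular point there are two distinct one-shot centres.
[folklore] -/
theorem exists_two_oneShotCentres_of_hypothesis (p : ℕ)
    (h : ∀ d : ℕ, ∀ (K : Type) [Field K] [CharP K p] (A : Type) [CommRing A] [IsDomain A]
      [Algebra K A] [Algebra.FiniteType K A], ringKrullDim A < (d : WithBot ℕ∞) →
      ∃ I : Ideal A, I ≠ ⊥ ∧ Scheme.IsRegular (affineBlowup I) ∧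
        ∀ 𝔭 : PrimeSpectrum A, I ≤ 𝔭.asIdeal ↔
          ¬ IsRegularLocalRing (Localization.AtPrime 𝔭.asIdeal))
    (K : Type) [Field K] [CharP K p] (A : Type) [CommRing A] [IsDomain A] [Algebra K A]
    [Algebra.FiniteType K A]
    (hsing : ∃ 𝔭 : PrimeSpectrum A, ¬ IsRegularLocalRing (Localization.AtPrime 𝔭.asIdeal)) :
    ∃ I J : Ideal A, I ≠ J ∧
      (I ≠ ⊥ ∧ Scheme.IsRegular (affineBlowup I) ∧
        ∀ 𝔭 : PrimeSpectrum A, I ≤ 𝔭.asIdeal ↔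
          ¬ IsRegularLocalRing (Localization.AtPrime 𝔭.asIdeal)) ∧
      (J ≠ ⊥ ∧ Scheme.IsRegular (affineBlowup J) ∧
        ∀ 𝔭 : PrimeSpectrum A, J ≤ 𝔭.asIdeal ↔
          ¬ IsRegularLocalRing (Localization.AtPrime 𝔭.asIdeal)) := by
  haveI : IsNoetherianRing A := Algebra.FiniteType.isNoetherianRing K A
  -- a finite-type algebra over a field has finite Krull dimension
  obtain ⟨d, hd⟩ : ∃ d : ℕ, ringKrullDim A < (d : WithBot ℕ∞) := by
    obtain ⟨n, hn, -⟩ := exists_ringKrullDim_eq_and_trdeg_eq K A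
    exact ⟨n + 1, by rw [hn]; exact_mod_cast Nat.lt_succ_self n⟩
  obtain ⟨I, hI⟩ := h d K A hd
  obtain ⟨J, hJI, hJ⟩ := exists_ne_oneShotCentre hI hsing
  exact ⟨I, J, hJI.symm, hI, hJ⟩

end Summit.ResolutionOfSingularities.ResolutionOfSingularities.Theorems.AffineToGlobal.Negative

end
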